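import Literature.NumberTheory.Automorphic.UnitaryThreeTorusDoubleCosetsHK          -- ★ hA p841445 (+ γ2b-A, bridge, γ2a, γ0, B-p17 DEFS `flickerKH`)
import Literature.NumberTheory.LocalFields.UnramifiedQuadraticNormSurjective         -- ★ Serre V §2 Prop. 3: 1-units are norms
import HarnessLib

/-!
# The type-(2) (RAMIFIED) torus of `H ≤ U(Φ₃)`: representatives `r(2a)`, `r(2a+1)`, the torus blocks `λ·D₁⁻¹ι(x + y√π₀)D₁ ⊕ 1`, 1-units are norms,
and the assembly step of Flicker's Proposition 6 (a)
(Flicker (1998), *Elementary proof of the fundamental lemma for a unitary group*, Prop. 6 (second half) p. 83; Serre, *Local Fields*, Ch. V §2 Prop. 3)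

Topic `NumberTheory/Automorphic`; namespace `Literature.NumberTheory.Automorphic.UnitaryGroup`.  KERNEL mathematics only: theorems, no definition, no
named fact, no instance, no notation, no `sorry`.  Cell `pub/hodgecm-mathlib`, programme P3a, road «D-N7-inert», MAP v3 «N7-ns COUNT FROM FLICKER», brick
γ2′ «THE RAMIFIED ∕ TYPE-(2) TRANSPORT» (LEAD F0P3a-plan (g9) T8-84 (2); B-p04 (g33) «=» (D1)–(D3)) — FILE `hA′` PART 1 (the pieces); PART 2
`UnitaryThreeRamifiedTorusDoubleCosetsHK` assembles Prop. 6 (a) for the ramified torus from them.  HC_CM is proved only modulo the printed citations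
(2 remaining named inputs hLiu418, h413) until rung 0 closes; this file discharges no named fact.

CONTENTS.  §1 (pure algebra in `U(σ, Φ₃)`): `exists_ramifiedRep` — a function `r : ℕ → Z_U(c)` with `r(2a) = diag(ϖ^{−a},1,ϖ^{a})` and
`r(2a+1) = !![0,0,ϖ^{a+1}∕d; 0,1,0; −dϖ^{−(a+1)},0,0]` (Flicker's `r_j = (0 1;1 0)^j(…)`; the SAME `r` as ★ hB′ `eq_of_centralizer_mul_ramifiedRep_mul_flickerKH_eq`);
`exists_coe_eq_ramifiedTorusBlock` — for `σ`-fixed `x y π₀` and `λσλ(x² − π₀y²) = 1` the block `!![λx,0,λπ₀y∕d; 0,1,0; λyd,0,λx] ∈ U` (★ γ0 converse), and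
`ramifiedTorusBlock_mem_centralizer` — it commutes with every `t′ = !![A,0,B;0,b,0;C,0,A]`, `B = Cρ`, `π₀ = d²ρ`.  §2 (valued frame, bridge `(R, ι)`):
`exists_mul_map_eq_of_v_sub_one_lt` — a `σ`-fixed `x` with `|x − 1| < 1` is `μσμ` with `|μ| = 1` (Serre V §2 Prop. 3 a) through ★
`UnramifiedQuadraticNormSurjective.exists_mul_map_eq_of_sub_one_mem`, `R` complete for `𝔪`, trace element `½`); `exists_eq_centralizer_mul_rep_mul_flickerKH` —
the assembly `τ·r_n·kM = g` (matrices, `kM` integral) ⇒ `g = τ′·r_n·k` in `H` with `τ′ ∈ Z_H(t)`, `k ∈ K_H`.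

References: [Flicker1998UnitaryFL] Y. Z. Flicker, Canad. J. Math. 50 (1998), Prop. 6 p. 83, REMARK p. 84 · [Serre1979] J.-P. Serre, *Local Fields*, GTM 67,
Ch. V §2 Prop. 3 · [Rogawski1990] J. D. Rogawski, Ann. of Math. Stud. 123, §4.9 p. 55. -/

set_option autoImplicit false

open Matrix
open scoped MatrixGroups WithZero

namespace Literature.NumberTheory.Automorphic.UnitaryGroup

open Literature.NumberTheory.Automorphic.HermitianLattice (unitaryInt LocalConjDatum)
open Literature.NumberTheory.LocalFields.UnramifiedQuadraticNorm (exists_mul_map_eq_of_sub_one_mem map_mem_maximalIdeal)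

universe u

/-! ## §1 The representatives `r(2a) = diag(ϖ^{−a},1,ϖ^{a})`, `r(2a+1) = antidiag-type`, and the ramified torus blocks -/

section Algebra

variable {K : Type*} [Field K] (σ : K →+* K) {J : Matrix (Fin 3) (Fin 3) K} (hJ : J = (StdForm.antidiagonal 3).over K)

include hJ in
/-- **The two-family representatives as a function `r : ℕ → Z_U(c)`**: `r(2a) = diag(ϖ^{−a}, 1, ϖ^{a})` and `r(2a+1) = !![0,0,ϖ^{a+1}∕d; 0,1,0; −d·ϖ^{−(a+1)},0,0]`
(`σϖ = ϖ ≠ 0`, `σd = −d ≠ 0`) — Flicker's `r_j = (0 1; 1 0)^j (…)` for the type-(2) torus, in the `U(Φ₃)` frame; the `r` of ★ `FixedPointsTorusDoubleCosetCount`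
and of ★ `eq_of_centralizer_mul_ramifiedRep_mul_flickerKH_eq`. [cite: Flicker1998UnitaryFL, Prop. 6 p. 83] -/
theorem exists_ramifiedRep {ϖ d : K} (hϖσ : σ ϖ = ϖ) (hϖ0 : ϖ ≠ 0) (hdσ : σ d = -d) (hd0 : d ≠ 0)
    {c : ↥(unitaryGroupOfForm σ J)} (hc : ((c : GL (Fin 3) K) : Matrix (Fin 3) (Fin 3) K) = !![1, 0, 0; 0, -1, 0; 0, 0, 1]) :
    ∃ r : ℕ → ↥(Subgroup.centralizer ({c} : Set ↥(unitaryGroupOfForm σ J))),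
      (∀ a : ℕ, (((r (2 * a) : ↥(unitaryGroupOfForm σ J)) : GL (Fin 3) K) : Matrix (Fin 3) (Fin 3) K) =
        !![(ϖ ^ a)⁻¹, 0, 0; 0, 1, 0; 0, 0, ϖ ^ a]) ∧
      (∀ a : ℕ, (((r (2 * a + 1) : ↥(unitaryGroupOfForm σ J)) : GL (Fin 3) K) : Matrix (Fin 3) (Fin 3) K) =
        !![0, 0, ϖ ^ (a + 1) / d; 0, 1, 0; -d * (ϖ ^ (a + 1))⁻¹, 0, 0]) := by
  obtain ⟨rE, hrE⟩ := exists_diagRadial σ hJ hϖσ hϖ0 hc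
  have key : ∀ a : ℕ, ∃ ra : ↥(Subgroup.centralizer ({c} : Set ↥(unitaryGroupOfForm σ J))),
      (((ra : ↥(unitaryGroupOfForm σ J)) : GL (Fin 3) K) : Matrix (Fin 3) (Fin 3) K) =
        !![0, 0, ϖ ^ (a + 1) / d; 0, 1, 0; -d * (ϖ ^ (a + 1))⁻¹, 0, 0] := by
    intro a
    have hX0 : ϖ ^ (a + 1) ≠ 0 := pow_ne_zero _ hϖ0
    have hσX : σ (ϖ ^ (a + 1)) = ϖ ^ (a + 1) := by rw [map_pow, hϖσ]
    obtain ⟨h, hh⟩ := exists_coe_eq_block_of_rel σ hJ (α := 0) (β := ϖ ^ (a + 1) / d) (γ := -d * (ϖ ^ (a + 1))⁻¹) (δ := 0)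
      (e := 1) (by rw [map_zero]; ring)
      (by rw [map_zero, map_mul, map_neg, hdσ, neg_neg, map_inv₀, hσX]; field_simp; ring)
      (by rw [map_zero, map_div₀, hσX, hdσ]; field_simp; ring)
      (by rw [map_zero]; ring) (by rw [map_one, mul_one])
    exact ⟨⟨h, mem_centralizer_of_coe_eq_block σ hc hh⟩, hh⟩
  choose rO hrO using key
  refine ⟨fun n => if n % 2 = 0 then rE (n / 2) else rO (n / 2), fun a => ?_, fun a => ?_⟩
  · have h1 : (if (2 * a) % 2 = 0 then rE ((2 * a) / 2) else rO ((2 * a) / 2)) = rE a := by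
      rw [if_pos (by omega), show (2 * a) / 2 = a by omega]
    dsimp only
    rw [h1]; exact hrE a
  · have h1 : (if (2 * a + 1) % 2 = 0 then rE ((2 * a + 1) / 2) else rO ((2 * a + 1) / 2)) = rO a := by
      rw [if_neg (by omega), show (2 * a + 1) / 2 = a by omega]
    dsimp only
    rw [h1]; exact hrO a

include hJ in
/-- **THE RAMIFIED TORUS BLOCK `τ = λ·D₁⁻¹ ι(x + y√π₀) D₁ ⊕ 1`**: for `σ`-fixed `x y π₀` and `λ` with `λσλ·(x² − π₀y²) = 1` the block
`!![λx, 0, λπ₀y∕d; 0, 1, 0; λyd, 0, λx]` is in `U(σ, Φ₃)` (★ γ0 converse + ★ block constructor). [cite: Flicker1998UnitaryFL, Prop. 6 p. 83] -/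
theorem exists_coe_eq_ramifiedTorusBlock {d : K} (hd : σ d = -d) (hd0 : d ≠ 0) {x y π₀ lam : K}
    (hx : σ x = x) (hy : σ y = y) (hπ₀σ : σ π₀ = π₀) (hN : lam * σ lam * (x * x - π₀ * y * y) = 1) :
    ∃ τ : ↥(unitaryGroupOfForm σ J), ((τ : GL (Fin 3) K) : Matrix (Fin 3) (Fin 3) K) =
      !![lam * x, 0, lam * (π₀ * y) / d; 0, 1, 0; lam * y * d, 0, lam * x] := by
  obtain ⟨R1, R2, R3, R4⟩ := SplitDictionary.rel_of_fixed_coords σ hd hd0 (a := x) (b := π₀ * y) (c := y) (e := x) (l := lam)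
    hx (by rw [map_mul, hπ₀σ, hy]) hy hx hN
  exact exists_coe_eq_block_of_rel σ hJ R1 R2 R3 R4 (e := 1) (by rw [map_one, mul_one])

/-- **The ramified torus block commutes with `t′`** (`t′ = !![A,0,B;0,b,0;C,0,A]`, `C ≠ 0`, `B = Cρ`, `π₀ = d²ρ`): its corner has equal diagonal entries and
`(λπ₀y∕d)·C = B·(λyd)`. [cite: Flicker1998UnitaryFL, Prop. 6 p. 83] -/
theorem ramifiedTorusBlock_mem_centralizer {τ t : ↥(unitaryGroupOfForm σ J)} {d x y π₀ lam ρ A B C b : K} (hd0 : d ≠ 0)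
    (hτ : ((τ : GL (Fin 3) K) : Matrix (Fin 3) (Fin 3) K) = !![lam * x, 0, lam * (π₀ * y) / d; 0, 1, 0; lam * y * d, 0, lam * x])
    (ht : ((t : GL (Fin 3) K) : Matrix (Fin 3) (Fin 3) K) = !![A, 0, B; 0, b, 0; C, 0, A]) (hC : C ≠ 0) (hBC : B = C * ρ)
    (hπ₀ : π₀ = d ^ 2 * ρ) : τ ∈ Subgroup.centralizer ({t} : Set ↥(unitaryGroupOfForm σ J)) := by
  rw [mem_centralizer_block_iff σ hτ ht hC]
  refine ⟨rfl, ?_⟩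
  rw [hBC, hπ₀]; field_simp

end Algebra

/-! ## §2 Valued frame: 1-units are norms (through the bridge) and the assembly step -/

section Main

variable {K : Type*} [Field K] [Valued K ℤᵐ⁰] {ϖ : K} (σ : K →+* K) {J : Matrix (Fin 3) (Fin 3) K}
  (hJ : J = (StdForm.antidiagonal 3).over K) (hd : LocalConjDatum σ ϖ)

/-- **1-UNITS OF `F` ARE NORMS FROM `E`, read in `K`** (Serre V §2 Prop. 3 a) `N(U_L^1) = U_K^1` through the bridge `(R, ι)`): for `σx = x` with `|x − 1| < 1`
there is `μ ∈ K` with `μ·σμ = x` and `|μ| = 1` (`R` complete for `𝔪`; the trace hits `1` at `t = ½`). [cite: Serre1979, Ch. V §2 Prop. 3] -/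
theorem exists_mul_map_eq_of_v_sub_one_lt
    {R : Type u} [CommRing R] [IsDomain R] [IsDiscreteValuationRing R] [IsAdicComplete (IsLocalRing.maximalIdeal R) R]
    (ι : R →+* K) (hι : Function.Injective ι) (hιv : ∀ x : K, Valued.v x ≤ 1 ↔ x ∈ Set.range ι)
    (σR : R →+* R) (hσR : ∀ r, σR (σR r) = r) (hσι : ∀ r, ι (σR r) = σ (ι r)) (h2R : IsUnit (2 : R))
    {x : K} (hσx : σ x = x) (hx : Valued.v (x - 1) < 1) : ∃ μ : K, μ * σ μ = x ∧ Valued.v μ = 1 := by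
  have hx1 : Valued.v x = 1 := by
    have e : x = 1 + (x - 1) := by ring
    rw [e]; exact Valuation.map_one_add_of_lt _ hx
  obtain ⟨xr, hσxr, hxr⟩ := TorusBridge.exists_lift_fixed σ ι hι hιv σR hσι hx1.le hσx
  have hmem : xr - 1 ∈ IsLocalRing.maximalIdeal R := by
    rw [IsLocalRing.mem_maximalIdeal, mem_nonunits_iff]
    intro hu
    have h1 := TorusBridge.v_eq_one_of_isUnit ι hιv hu
    rw [map_sub, map_one, hxr] at h1
    exact (ne_of_lt hx) h1
  -- the trace element `½`
  obtain ⟨two, htwo⟩ := h2R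
  have h2t : (2 : R) * (↑two⁻¹ : R) = 1 := by rw [← htwo]; exact two.mul_inv
  have hσt : σR (↑two⁻¹ : R) = ↑two⁻¹ := by
    have h1 := congrArg σR h2t
    rw [map_mul, map_ofNat, map_one] at h1
    calc σR (↑two⁻¹ : R) = σR ↑two⁻¹ * ((2 : R) * ↑two⁻¹) := by rw [h2t, mul_one]
      _ = (2 : R) * σR ↑two⁻¹ * ↑two⁻¹ := by ring
      _ = ↑two⁻¹ := by rw [h1, one_mul]
  have ht : (↑two⁻¹ : R) + σR ↑two⁻¹ = 1 := by rw [hσt, ← two_mul, h2t]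
  obtain ⟨s, hs, -⟩ := exists_mul_map_eq_of_sub_one_mem σR hσR (map_mem_maximalIdeal σR hσR) ht hσxr hmem
  refine ⟨ι s, ?_, ?_⟩
  · rw [← hσι, ← map_mul, hs, hxr]
  · have hx0 : x ≠ 0 := fun h0 => by rw [h0, map_zero] at hx1; exact zero_ne_one hx1
    have hxu : IsUnit xr := by
      obtain ⟨w, hw⟩ := (hιv (ι xr)⁻¹).1 (by rw [map_inv₀, hxr, hx1, inv_one])
      exact isUnit_iff_exists_inv.2 ⟨w, hι (by rw [map_mul, hw, hxr, mul_inv_cancel₀ hx0, map_one])⟩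
    rw [← hs] at hxu
    exact TorusBridge.v_eq_one_of_isUnit ι hιv (isUnit_of_mul_isUnit_left hxu)

include hJ hd in
/-- **ASSEMBLY**: if `τ ∈ Z_U(c) ∩ Z_U(t)` and a matrix `kM` with integral entries satisfy `τ · r_n · kM = g` (as matrices), then `g = τ′ · r_n · k` with
`τ′ ∈ Z_H(t)` and `k ∈ K_H = flickerKH.subgroupOf H` (`k := r_n⁻¹ τ⁻¹ g` has matrix `kM`; integrality ⇒ `k ∈ unitaryInt`, ★ `mem_unitaryInt_iff_forall_v_apply_le_one`).
[cite: Flicker1998UnitaryFL, Prop. 6 p. 83] -/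
theorem exists_eq_centralizer_mul_rep_mul_flickerKH {c : ↥(unitaryGroupOfForm σ J)}
    (r : ℕ → ↥(Subgroup.centralizer ({c} : Set ↥(unitaryGroupOfForm σ J)))) (n : ℕ)
    (g : ↥(Subgroup.centralizer ({c} : Set ↥(unitaryGroupOfForm σ J))))
    {t : ↥(unitaryGroupOfForm σ J)} (htH : t ∈ Subgroup.centralizer ({c} : Set ↥(unitaryGroupOfForm σ J)))
    {τ : ↥(unitaryGroupOfForm σ J)} (hτc : τ ∈ Subgroup.centralizer ({c} : Set ↥(unitaryGroupOfForm σ J)))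
    (hτt : τ ∈ Subgroup.centralizer ({t} : Set ↥(unitaryGroupOfForm σ J))) {kM : Matrix (Fin 3) (Fin 3) K}
    (hprod : ((τ : GL (Fin 3) K) : Matrix (Fin 3) (Fin 3) K) * (((r n : ↥(unitaryGroupOfForm σ J)) : GL (Fin 3) K) : Matrix (Fin 3) (Fin 3) K) * kM =
      (((g : ↥(unitaryGroupOfForm σ J)) : GL (Fin 3) K) : Matrix (Fin 3) (Fin 3) K))
    (hkv : ∀ a b, Valued.v (kM a b) ≤ 1) :
    ∃ τ' ∈ Subgroup.centralizer ({⟨t, htH⟩} : Set ↥(Subgroup.centralizer ({c} : Set ↥(unitaryGroupOfForm σ J)))),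
      ∃ k ∈ (flickerKH σ J c).subgroupOf (Subgroup.centralizer ({c} : Set ↥(unitaryGroupOfForm σ J))), g = τ' * r n * k := by
  obtain ⟨τH, hτH'⟩ : ∃ τH : ↥(Subgroup.centralizer ({c} : Set ↥(unitaryGroupOfForm σ J))), (τH : ↥(unitaryGroupOfForm σ J)) = τ :=
    ⟨⟨τ, hτc⟩, rfl⟩
  have hτHZ : τH ∈ Subgroup.centralizer ({⟨t, htH⟩} : Set ↥(Subgroup.centralizer ({c} : Set ↥(unitaryGroupOfForm σ J)))) := by
    rw [Subgroup.mem_centralizer_singleton_iff]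
    apply Subtype.ext
    change (τH : ↥(unitaryGroupOfForm σ J)) * t = t * (τH : ↥(unitaryGroupOfForm σ J))
    rw [hτH']
    exact Subgroup.mem_centralizer_singleton_iff.1 hτt
  obtain ⟨k, hk⟩ : ∃ k : ↥(Subgroup.centralizer ({c} : Set ↥(unitaryGroupOfForm σ J))), k = (r n)⁻¹ * τH⁻¹ * g := ⟨_, rfl⟩
  have hkM : (((k : ↥(unitaryGroupOfForm σ J)) : GL (Fin 3) K) : Matrix (Fin 3) (Fin 3) K) = kM := by
    have hτu : IsUnit (((τ : GL (Fin 3) K) : Matrix (Fin 3) (Fin 3) K)).det := Matrix.isUnits_det_units _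
    have hru : IsUnit ((((r n : ↥(unitaryGroupOfForm σ J)) : GL (Fin 3) K) : Matrix (Fin 3) (Fin 3) K)).det := Matrix.isUnits_det_units _
    have e1 : ((k : ↥(unitaryGroupOfForm σ J)) : GL (Fin 3) K) =
        ((r n : ↥(unitaryGroupOfForm σ J)) : GL (Fin 3) K)⁻¹ * (τ : GL (Fin 3) K)⁻¹ * ((g : ↥(unitaryGroupOfForm σ J)) : GL (Fin 3) K) := by
      rw [hk, ← hτH']; simp only [Subgroup.coe_mul, Subgroup.coe_inv]
    rw [e1, Units.val_mul, Units.val_mul, Matrix.coe_units_inv, Matrix.coe_units_inv, ← hprod,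
      Matrix.mul_assoc (((τ : GL (Fin 3) K) : Matrix (Fin 3) (Fin 3) K)), Matrix.mul_assoc, Matrix.nonsing_inv_mul_cancel_left _ _ hτu,
      Matrix.nonsing_inv_mul_cancel_left _ _ hru]
  have hkK : k ∈ (flickerKH σ J c).subgroupOf (Subgroup.centralizer ({c} : Set ↥(unitaryGroupOfForm σ J))) := by
    rw [Subgroup.mem_subgroupOf, mem_flickerKH_iff]
    refine ⟨(k : ↥(Subgroup.centralizer ({c} : Set ↥(unitaryGroupOfForm σ J)))).2, ?_⟩
    rw [mem_unitaryInt_iff_forall_v_apply_le_one σ hJ hd.vσ, hkM]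
    exact hkv
  refine ⟨τH, hτHZ, k, hkK, ?_⟩
  rw [hk]; group

end Main

end Literature.NumberTheory.Automorphic.UnitaryGroup
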